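import Literature.Combinatorics.SimpleGraph.LovaszThetaFrankWolfe
import Mathlib.LinearAlgebra.Matrix.Symmetric
import Mathlib.Data.Nat.Log
import HarnessLib

/-!
# An integer Frank–Wolfe algorithm for the Lovász number: definitions and exact-arithmetic identities

Topic `Combinatorics/SimpleGraph`, continuing `LovaszThetaFrankWolfe.lean`. This file DEFINES the
finite-precision algorithm whose polynomial-time implementation discharges
`Literature.Computability.Complexity.GLS1981_thetaApprox_unary_FP` (input: a graph `H` on `n ≥ 1`
vertices and an accuracy parameter `m ≥ 1`; output: an integer `z` with `mϑ(H) ≤ z ≤ mϑ(H) + 2`),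
and proves the identities linking its INTEGER state to the real Frank–Wolfe iterates of
`frankWolfe_powerStep` (Hazan's spectraplex Frank–Wolfe, Jaggi 2011 Alg. 6, with the power-method
oracle of `PowerMethodTrace.lean` and the penalised objective `f_M` of `LovaszThetaPenalty.lean`).
The convergence and output analysis is in `LovaszThetaFWCorrect.lean`.

**The algorithm** (`ThetaFW`; all constants are explicit polynomials in `n, m`): `M = n⁶m`,
`c₀ = n(1+2M)`, `q = 32mc₀` (oracle accuracy `ε = 1/q`), `k = ⌊log₂(nq)⌋ + 1`, power exponent
`r = qk`, `T = 512 n⁶ m²` iterations, `p = ⌊log₂(2¹⁵n¹⁶m⁴)⌋ + 1` bits. State: a symmetric integer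
matrix `N` (positive semidefinite, trace `τ > 0`; it represents `B = N/τ ∈ Δ`), `N₀ = 1`. Step `t`:
`A = τ·J - 2M·N_E + τc₀·1` (`gradInt`; `= τ (∇f_M(B) + c₀·1)`), `P = Aʳ` (`powInt`),
`Ñᵢⱼ = ⌊2ᵖ (t Nᵢⱼ Tr P + 2 τ Pᵢⱼ) / ((t+2) τ Tr P)⌋` (`= ⌊2ᵖ Yᵢⱼ⌋` for the exact Frank–Wolfe
iterate `Y = (t B + 2 P/Tr P)/(t+2)`), `N⁺ = Ñ + n·1` (`fwStep`; the `n·1` restores positive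
semidefiniteness lost by rounding). Output after `T` steps:
`z = ⌈(8m(τ Σᵢⱼ Nᵢⱼ - M Σ_E Nᵢⱼ²) + 3τ²)/(8τ²)⌉ = ⌈m f_M(B_T) + 3/8⌉` (`thetaZ`).

**Proved here**: symmetry of all iterates (`isSymm_fwIter`), the cast identities
`gradInt = τ (∇f + c₀·1)` (`toR_gradInt`), `powInt = τʳ Aʳ` (`toR_powInt`), the exact step
`stepNum/stepDen = 2ᵖ Yᵢⱼ` (`stepNum_div_stepDen`) and the floor bracket of integer division
(`ediv_bracket`), and the output identity `outNum/(8τ²) = m f_M(B) + 3/8` (`outNum_div`).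

## References

* M. Jaggi, arXiv:1108.1170 (2011), Alg. 6 (Hazan's algorithm), Thm. 17–18 [Jaggi2011];
  E. Hazan, LATIN 2008 [Hazan2008].
* M. Grötschel, L. Lovász, A. Schrijver, Combinatorica 1 (1981), §6 [GrotschelLovaszSchrijver1981]
  (the statement being discharged; their algorithm is the ellipsoid method, not this one).
-/

noncomputable section

open Matrix Finset

namespace Literature.Combinatorics.SimpleGraph

namespace ThetaFW

variable (n m : ℕ) (H : _root_.SimpleGraph (Fin n)) [DecidableRel H.Adj]

/-! ### Constants -/

/-- The penalty weight `M = n⁶ m`. [folklore] -/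
def cM : ℕ := n ^ 6 * m

/-- The diagonal shift `c₀ = n (1 + 2M)` making the gradient positive semidefinite. [folklore] -/
def c0 : ℕ := n * (1 + 2 * cM n m)

/-- The inverse oracle accuracy `q = 32 m c₀` (`ε = 1/q`). [folklore] -/
def cq : ℕ := 32 * m * c0 n m

/-- `k = ⌊log₂(n q)⌋ + 1`, so that `2ᵏ > n q`. [folklore] -/
def ck : ℕ := Nat.log 2 (n * cq n m) + 1

/-- The power exponent `r = q k` (then `n (1 - 1/q)ʳ ≤ 1/q`). [folklore] -/
def cr : ℕ := cq n m * ck n m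

/-- The number of Frank–Wolfe iterations `T = 512 n⁶ m²`. [folklore] -/
def cT : ℕ := 512 * n ^ 6 * m ^ 2

/-- The precision `p = ⌊log₂(2¹⁵ n¹⁶ m⁴)⌋ + 1` bits (then `2ᵖ > 2¹⁵ n¹⁶ m⁴`). [folklore] -/
def cp : ℕ := Nat.log 2 (2 ^ 15 * n ^ 16 * m ^ 4) + 1

/-! ### The integer iteration -/

/-- The shifted, scaled gradient `A = τ·J - 2M·N_E + τc₀·1` (`τ = Tr N`), an integer matrix equal to
`τ (∇f_M(N/τ) + c₀·1)` (`toR_gradInt`). [cite: Jaggi2011, §4, Alg. 6 and the diagonal shift (chunk p0022)] -/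
def gradInt (N : Matrix (Fin n) (Fin n) ℤ) : Matrix (Fin n) (Fin n) ℤ := fun i j =>
  N.trace - (if H.Adj i j then 2 * (cM n m : ℤ) * N i j else 0) +
    (if i = j then N.trace * (c0 n m : ℤ) else 0)

/-- The oracle matrix `P = Aʳ` (its normalisation `P / Tr P` is the approximate top eigen-direction
of the power method, `PowerMethodTrace.lean`). [cite: Jaggi2011, §4, Thm. 18 (chunk p0022)] -/
def powInt (N : Matrix (Fin n) (Fin n) ℤ) : Matrix (Fin n) (Fin n) ℤ := gradInt n m H N ^ cr n m

/-- Numerator of the rounded Frank–Wolfe step: `2ᵖ (t Nᵢⱼ Tr P + 2 τ Pᵢⱼ)`. [folklore] -/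
def stepNum (t : ℕ) (N P : Matrix (Fin n) (Fin n) ℤ) (i j : Fin n) : ℤ :=
  2 ^ cp n m * ((t : ℤ) * N i j * P.trace + 2 * N.trace * P i j)

/-- Denominator of the rounded Frank–Wolfe step: `(t+2) τ Tr P`. [folklore] -/
def stepDen (t : ℕ) (N P : Matrix (Fin n) (Fin n) ℤ) : ℤ := ((t : ℤ) + 2) * N.trace * P.trace

/-- **One step**: `N⁺ᵢⱼ = ⌊2ᵖ (t Nᵢⱼ Tr P + 2 τ Pᵢⱼ) / ((t+2) τ Tr P)⌋ + n [i = j]`, `P = Aʳ`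
(Lean's integer division is the floor for a positive divisor). [cite: Jaggi2011, Alg. 6 (chunk p0020)] -/
def fwStep (t : ℕ) (N : Matrix (Fin n) (Fin n) ℤ) : Matrix (Fin n) (Fin n) ℤ := fun i j =>
  stepNum n m t N (powInt n m H N) i j / stepDen n t N (powInt n m H N) + if i = j then (n : ℤ) else 0

/-- **The iterates** `N₀ = 1`, `Nₜ₊₁ = fwStep t Nₜ`. [cite: Jaggi2011, Alg. 6 (chunk p0020)] -/
def fwIter : ℕ → Matrix (Fin n) (Fin n) ℤ
  | 0 => 1
  | t + 1 => fwStep n m H t (fwIter t)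

/-- The final state after `T` steps. [folklore] -/
def fwFinal : Matrix (Fin n) (Fin n) ℤ := fwIter n m H (cT n m)

/-- `Σᵢⱼ Nᵢⱼ`. [folklore] -/
def eSumInt (N : Matrix (Fin n) (Fin n) ℤ) : ℤ := ∑ i, ∑ j, N i j

/-- `Σ_{ij ∈ E⃗} Nᵢⱼ²` (ordered pairs). [folklore] -/
def qSumInt (N : Matrix (Fin n) (Fin n) ℤ) : ℤ := ∑ i, ∑ j, if H.Adj i j then N i j ^ 2 else 0

/-- The output numerator `8m(τ Σ Nᵢⱼ - M Σ_E Nᵢⱼ²) + 3τ²`. [folklore] -/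
def outNum (N : Matrix (Fin n) (Fin n) ℤ) : ℤ :=
  8 * (m : ℤ) * (N.trace * eSumInt n N - (cM n m : ℤ) * qSumInt n H N) + 3 * N.trace ^ 2

/-- Ceiling division `⌈a/b⌉ = -((-a)/b)` (for `b > 0`, with Lean's flooring `/`). [folklore] -/
def ceilDiv (a b : ℤ) : ℤ := -((-a) / b)

/-- **The output** `z = ⌈(8m(τ Σ Nᵢⱼ - M Σ_E Nᵢⱼ²) + 3τ²) / (8τ²)⌉ = ⌈m f_M(B_T) + 3/8⌉`.
[folklore] -/
def thetaZ : ℤ := ceilDiv (outNum n m H (fwFinal n m H)) (8 * (fwFinal n m H).trace ^ 2)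

/-! ### Symmetry of the iterates -/

variable {n m H}

/-- `gradInt` of a symmetric matrix is symmetric. [folklore] -/
theorem isSymm_gradInt {N : Matrix (Fin n) (Fin n) ℤ} (hN : N.IsSymm) : (gradInt n m H N).IsSymm := by
  ext i j
  have hij : N j i = N i j := by
    have h := congrFun (congrFun hN i) j
    simpa [Matrix.transpose_apply] using h
  simp only [gradInt, Matrix.transpose_apply, H.adj_comm i j, hij, eq_comm (a := j) (b := i)]

/-- `powInt` of a symmetric matrix is symmetric. [folklore] -/
theorem isSymm_powInt {N : Matrix (Fin n) (Fin n) ℤ} (hN : N.IsSymm) : (powInt n m H N).IsSymm :=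
  (isSymm_gradInt hN).pow _

/-- `fwStep` of a symmetric matrix is symmetric. [folklore] -/
theorem isSymm_fwStep (t : ℕ) {N : Matrix (Fin n) (Fin n) ℤ} (hN : N.IsSymm) :
    (fwStep n m H t N).IsSymm := by
  ext i j
  have hij : N j i = N i j := by
    have h := congrFun (congrFun hN i) j
    simpa [Matrix.transpose_apply] using h
  have hP : powInt n m H N j i = powInt n m H N i j := by
    have h := congrFun (congrFun (isSymm_powInt (m := m) (H := H) hN) i) j
    simpa [Matrix.transpose_apply] using h
  simp only [fwStep, stepNum, Matrix.transpose_apply, hij, hP, eq_comm (a := j) (b := i)]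

/-- **All iterates are symmetric.** [folklore] -/
theorem isSymm_fwIter : ∀ t, (fwIter n m H t).IsSymm
  | 0 => isSymm_one
  | t + 1 => isSymm_fwStep t (isSymm_fwIter t)

/-! ### Casting to real matrices -/

/-- The real matrix of an integer matrix. [folklore] -/
def toR (N : Matrix (Fin n) (Fin n) ℤ) : Matrix (Fin n) (Fin n) ℝ := N.map (Int.cast : ℤ → ℝ)

/-- Entries of the cast. [folklore] -/
@[simp] theorem toR_apply (N : Matrix (Fin n) (Fin n) ℤ) (i j : Fin n) : toR N i j = (N i j : ℝ) := rfl

/-- The cast is a ring homomorphism (`Int.castRingHom` on matrices). [folklore] -/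
theorem toR_eq_mapMatrix (N : Matrix (Fin n) (Fin n) ℤ) : toR N = (Int.castRingHom ℝ).mapMatrix N := by
  ext i j; simp [toR]

/-- The cast commutes with powers. [folklore] -/
theorem toR_pow (N : Matrix (Fin n) (Fin n) ℤ) (r : ℕ) : toR (N ^ r) = toR N ^ r := by
  rw [toR_eq_mapMatrix, toR_eq_mapMatrix, map_pow]

/-- The cast commutes with the trace. [folklore] -/
theorem trace_toR (N : Matrix (Fin n) (Fin n) ℤ) : (toR N).trace = (N.trace : ℝ) := by
  simp [Matrix.trace, toR]

/-- The cast of a symmetric matrix is symmetric, entrywise. [folklore] -/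
theorem toR_comm {N : Matrix (Fin n) (Fin n) ℤ} (hN : N.IsSymm) (i j : Fin n) : toR N j i = toR N i j := by
  have h := congrFun (congrFun hN i) j
  simp only [Matrix.transpose_apply] at h
  simp [h]

/-- The cast of a symmetric matrix is Hermitian. [folklore] -/
theorem isHermitian_toR {N : Matrix (Fin n) (Fin n) ℤ} (hN : N.IsSymm) : (toR N).IsHermitian := by
  ext i j
  simp only [conjTranspose_apply, star_trivial]
  exact toR_comm hN i j

/-- The sum of entries commutes with the cast. [folklore] -/
theorem entrySum_toR (N : Matrix (Fin n) (Fin n) ℤ) : entrySum (toR N) = (eSumInt n N : ℝ) := by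
  simp [entrySum, eSumInt, toR]

/-- The edge sum of squares commutes with the cast. [folklore] -/
theorem edgeSqSum_toR (N : Matrix (Fin n) (Fin n) ℤ) : edgeSqSum H (toR N) = (qSumInt n H N : ℝ) := by
  simp only [edgeSqSum, qSumInt, toR_apply, Int.cast_sum]
  refine sum_congr rfl fun i _ => sum_congr rfl fun j _ => ?_
  split_ifs <;> simp

/-! ### The real objects represented by a state -/

/-- The represented point of the spectraplex `B = N / Tr N`. [folklore] -/
def bOf (N : Matrix (Fin n) (Fin n) ℤ) : Matrix (Fin n) (Fin n) ℝ := ((N.trace : ℝ))⁻¹ • toR N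

/-- The shifted gradient `A = ∇f_M(B) + c₀·1` at the represented point. [folklore] -/
def aOf (N : Matrix (Fin n) (Fin n) ℤ) : Matrix (Fin n) (Fin n) ℝ :=
  penaltyGrad H (cM n m : ℝ) (bOf N) + (c0 n m : ℝ) • (1 : Matrix (Fin n) (Fin n) ℝ)

/-- The oracle point `W = Aʳ / Tr(Aʳ)`. [folklore] -/
def wOf (N : Matrix (Fin n) (Fin n) ℤ) : Matrix (Fin n) (Fin n) ℝ :=
  ((aOf (m := m) (H := H) N ^ cr n m).trace)⁻¹ • aOf (m := m) (H := H) N ^ cr n m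

/-- The exact Frank–Wolfe iterate `Y = (t B + 2 W)/(t + 2) = (1 - α) B + α W`, `α = 2/(t+2)`.
[cite: Jaggi2011, Alg. 6 (chunk p0020)] -/
def yOf (t : ℕ) (N : Matrix (Fin n) (Fin n) ℤ) : Matrix (Fin n) (Fin n) ℝ :=
  (1 - 2 / ((t : ℝ) + 2)) • bOf N + (2 / ((t : ℝ) + 2)) • wOf (m := m) (H := H) N

/-- **`gradInt` is `τ (∇f_M(B) + c₀·1)`** for `τ = Tr N ≠ 0`. [folklore] -/
theorem toR_gradInt {N : Matrix (Fin n) (Fin n) ℤ} (hτ : N.trace ≠ 0) :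
    toR (gradInt n m H N) = (N.trace : ℝ) • aOf (m := m) (H := H) N := by
  have hτ' : (N.trace : ℝ) ≠ 0 := by exact_mod_cast hτ
  ext i j
  simp only [toR_apply, gradInt, aOf, bOf, penaltyGrad, Matrix.add_apply, Matrix.smul_apply,
    Matrix.one_apply, smul_eq_mul, toR_apply, Int.cast_add, Int.cast_sub, Int.cast_ite, Int.cast_mul,
    Int.cast_ofNat, Int.cast_natCast, Int.cast_zero]
  split_ifs <;> field_simp <;> ring

/-- **`powInt` is `τʳ Aʳ`.** [folklore] -/
theorem toR_powInt {N : Matrix (Fin n) (Fin n) ℤ} (hτ : N.trace ≠ 0) :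
    toR (powInt n m H N) = (N.trace : ℝ) ^ cr n m • aOf (m := m) (H := H) N ^ cr n m := by
  rw [powInt, toR_pow, toR_gradInt hτ, smul_pow]

/-- The trace of `powInt` is `τʳ Tr(Aʳ)`. [folklore] -/
theorem trace_powInt {N : Matrix (Fin n) (Fin n) ℤ} (hτ : N.trace ≠ 0) :
    ((powInt n m H N).trace : ℝ) = (N.trace : ℝ) ^ cr n m * (aOf (m := m) (H := H) N ^ cr n m).trace := by
  rw [← trace_toR, toR_powInt hτ, trace_smul, smul_eq_mul]

/-- The normalised oracle matrix: `P / Tr P = Aʳ / Tr(Aʳ) = W` (the `τʳ` cancels), entrywise.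
[folklore] -/
theorem powInt_div_trace {N : Matrix (Fin n) (Fin n) ℤ} (hτ : N.trace ≠ 0)
    (htrA : (aOf (m := m) (H := H) N ^ cr n m).trace ≠ 0) (i j : Fin n) :
    ((powInt n m H N i j : ℤ) : ℝ) / ((powInt n m H N).trace : ℝ) = wOf (m := m) (H := H) N i j := by
  have hτ' : (N.trace : ℝ) ≠ 0 := by exact_mod_cast hτ
  have hτr : (N.trace : ℝ) ^ cr n m ≠ 0 := pow_ne_zero _ hτ'
  have h1 : ((powInt n m H N i j : ℤ) : ℝ) = toR (powInt n m H N) i j := rfl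
  rw [h1, toR_powInt hτ, trace_powInt hτ, wOf]
  simp only [Matrix.smul_apply, smul_eq_mul]
  field_simp

/-- **The exact step**: `stepNum / stepDen = 2ᵖ Yᵢⱼ` as real numbers. [folklore] -/
theorem stepNum_div_stepDen (t : ℕ) {N : Matrix (Fin n) (Fin n) ℤ} (hτ : N.trace ≠ 0)
    (htrA : (aOf (m := m) (H := H) N ^ cr n m).trace ≠ 0) (i j : Fin n) :
    ((stepNum n m t N (powInt n m H N) i j : ℤ) : ℝ) / (stepDen n t N (powInt n m H N) : ℝ) =
      2 ^ cp n m * yOf (m := m) (H := H) t N i j := by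
  have hτ' : (N.trace : ℝ) ≠ 0 := by exact_mod_cast hτ
  have hP : ((powInt n m H N).trace : ℝ) ≠ 0 := by
    rw [trace_powInt hτ]; exact mul_ne_zero (pow_ne_zero _ hτ') htrA
  have ht : ((t : ℝ) + 2) ≠ 0 := by positivity
  have hW := powInt_div_trace (m := m) (H := H) hτ htrA i j
  rw [div_eq_iff hP] at hW
  simp only [stepNum, stepDen, yOf, bOf, Matrix.add_apply, Matrix.smul_apply, smul_eq_mul, toR_apply,
    Int.cast_mul, Int.cast_add, Int.cast_pow, Int.cast_ofNat, Int.cast_natCast]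
  rw [hW]
  field_simp
  ring

/-- **The floor bracket of integer division**: for `d > 0`, `a/d ≤ a/d (real) < a/d + 1`, i.e.
`d · (a/d) ≤ a < d · (a/d) + d`. [folklore] -/
theorem ediv_bracket (a : ℤ) {d : ℤ} (hd : 0 < d) :
    ((a / d : ℤ) : ℝ) ≤ (a : ℝ) / (d : ℝ) ∧ (a : ℝ) / (d : ℝ) < ((a / d : ℤ) : ℝ) + 1 := by
  have hd' : (0 : ℝ) < d := by exact_mod_cast hd
  have h1 : d * (a / d) + a % d = a := Int.mul_ediv_add_emod a d
  have h2 : 0 ≤ a % d := Int.emod_nonneg a hd.ne'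
  have h3 : a % d < d := Int.emod_lt_of_pos a hd
  have h1' : (d : ℝ) * ((a / d : ℤ) : ℝ) + ((a % d : ℤ) : ℝ) = a := by exact_mod_cast h1
  have h2' : (0 : ℝ) ≤ ((a % d : ℤ) : ℝ) := by exact_mod_cast h2
  have h3' : ((a % d : ℤ) : ℝ) < d := by exact_mod_cast h3
  constructor
  · rw [le_div_iff₀ hd']; nlinarith
  · rw [div_lt_iff₀ hd']; nlinarith

/-- Ceiling division is a ceiling: `a/b ≤ ⌈a/b⌉ < a/b + 1` for `b > 0`. [folklore] -/
theorem ceilDiv_bracket (a : ℤ) {b : ℤ} (hb : 0 < b) :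
    (a : ℝ) / (b : ℝ) ≤ (ceilDiv a b : ℝ) ∧ (ceilDiv a b : ℝ) < (a : ℝ) / (b : ℝ) + 1 := by
  obtain ⟨h1, h2⟩ := ediv_bracket (-a) hb
  simp only [ceilDiv, Int.cast_neg] at h1 h2 ⊢
  rw [neg_div] at h1 h2
  constructor <;> linarith

/-- **The output identity**: `outNum / (8τ²) = m f_M(B) + 3/8` for the represented point
`B = N/τ`, `τ ≠ 0`. [folklore] -/
theorem outNum_div {N : Matrix (Fin n) (Fin n) ℤ} (hτ : N.trace ≠ 0) :
    (outNum n m H N : ℝ) / ((8 * N.trace ^ 2 : ℤ) : ℝ) =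
      m * penaltyObj H (cM n m : ℝ) (bOf N) + 3 / 8 := by
  have hτ' : (N.trace : ℝ) ≠ 0 := by exact_mod_cast hτ
  have he : entrySum (bOf N) = ((N.trace : ℝ))⁻¹ * (eSumInt n N : ℝ) := by
    rw [bOf, entrySum_smul, entrySum_toR]
  have hq : edgeSqSum H (bOf N) = ((N.trace : ℝ))⁻¹ ^ 2 * (qSumInt n H N : ℝ) := by
    rw [bOf, edgeSqSum_smul, edgeSqSum_toR]
  rw [penaltyObj, he, hq]
  simp only [outNum, Int.cast_add, Int.cast_mul, Int.cast_sub, Int.cast_pow, Int.cast_ofNat,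
    Int.cast_natCast]
  field_simp

end ThetaFW

end Literature.Combinatorics.SimpleGraph

end
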